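import Literature.MathematicalPhysics.QuantumChemistry.SecondQuantizedHamiltonian
import Literature.MathematicalPhysics.QuantumChemistry.PositivityConditions
import HarnessLib

/-!
# Spin-sector (`S_z`) conditions on the reduced density matrices and the `S`-representability sum rule

Topic `Literature/MathematicalPhysics/QuantumChemistry`; companion of `PositivityConditions.lean` (cone
constraints) and `RDMLinearConditions.lean` (trace / contraction / antisymmetry at fixed TOTAL particle
number). This file vendors the SPIN structure of the same constraints for a vector `ψ` of the
`(N_α, N_β) = (a, b)` sector of the spinful Fock space over the spin orbitals `Orb Λ = Λ × {α, β}`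
(`IsInSector a b ψ`; `orb x 0 = xα`, `orb x 1 = xβ`), as printed in D. A. Mazziotti, *Variational
two-electron reduced-density-matrix theory* (Reduced-Density-Matrix Mechanics, Adv. Chem. Phys. 134,
Wiley 2007), Ch. 3 §II.F "Spin and spatial symmetry adaptation" and §II.F.1 "Spin adaptation and
`S`-representability" — the conditions a variational 2-RDM calculation "in which the basis functions
are only eigenfunctions of `Ŝ_z`" imposes (normalisation `⟨ψ, ψ⟩` kept explicit):

* `S_z` SELECTION RULE of the 1-RDM: `¹D^{pσ}_{qτ} = 0` for `σ ≠ τ` (`oneRDM_orb_eq_zero_of_ne`) — a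
  spin-charged word has zero expectation in an `Ŝ_z` eigenvector;
* spin-resolved TRACES of the 1-RDM: `Σ_x ¹D^{xα}_{xα} = N_α ⟨ψ,ψ⟩`, `Σ_x ¹D^{xβ}_{xβ} = N_β ⟨ψ,ψ⟩`
  (`sum_oneRDM_up`, `sum_oneRDM_down`);
* spin-resolved CONTRACTIONS of the 2-RDM onto the 1-RDM:
  `Σ_y ²D^{P, yσ}_{qτ, yσ} = (N_σ − δ_{στ}) ¹D^{P}_{qτ}` (`sum_twoRDM_orb_up`, `sum_twoRDM_orb_down`);
* the TRACES OF THE SPIN BLOCKS of the 2-RDM (Mazziotti eqs. (87)–(90) in second-quantised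
  normalisation, `N_α = N/2 + M`, `N_β = N/2 − M`): `Σ_{xy} ²D^{xα yα}_{xα yα} = N_α(N_α − 1) ⟨ψ,ψ⟩`
  (eq. (89), `sum_twoRDM_upUp`), `Σ_{xy} ²D^{xβ yβ}_{xβ yβ} = N_β(N_β − 1) ⟨ψ,ψ⟩` (eq. (90),
  `sum_twoRDM_downDown`), `Σ_{xy} ²D^{xα yβ}_{xα yβ} = N_α N_β ⟨ψ,ψ⟩` (the `αβ` block, eqs. (87)+(88),
  `sum_twoRDM_upDown`);
* the `S`-REPRESENTABILITY SUM RULE (eqs. (96)–(98)): the operator identity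
  `Ŝ_− Ŝ_+ = N̂_β − Σ_{xy} a†_{xα} a†_{yβ} a_{xβ} a_{yα}` (`spinMinus_mul_spinPlus_eq`), hence in the
  sector `⟨ψ| Ŝ_−Ŝ_+ |ψ⟩ + Σ_{xy} ²D^{xα, yβ}_{yα, xβ} = N_β ⟨ψ,ψ⟩`
  (`expect_spinMinus_spinPlus_add_sum_twoRDM`) — Mazziotti's eq. (98)
  `Σ_{ij} ²D^{iα,jβ}_{jα,iβ} = N/2 + M² − S(S+1)` once `⟨Ŝ_−Ŝ_+⟩ = S(S+1) − M(M+1)` is inserted; in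
  particular for a vector annihilated by `Ŝ_+` (the highest-weight / singlet-restricted states of the
  certified-quantum-chemistry cell's `⟨Ŝ²⟩ = S(S+1)` certificates)
  `Σ_{xy} ²D^{xα, yβ}_{yα, xβ} = N_β ⟨ψ,ψ⟩` (`sum_twoRDM_exchange_of_spinPlus_eq_zero`).

Everything is PROVED (0 sorry) from the CAR and the sector lemmas of
`Literature/MathematicalPhysics/QuantumLattice/HubbardSzSectorLadder.lean`; no definitions, no named
facts. What is NOT here: the spin-ADAPTED (total-`S`) blocks `²D^{0,0}`, `²D^{1,m}` themselves
(eqs. (79)–(86)) and spatial point-group blocking (§II.F, eq. (95)).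

## References
* D. A. Mazziotti, *Variational two-electron reduced-density-matrix theory*, in: D. A. Mazziotti
  (ed.), Reduced-Density-Matrix Mechanics, Adv. Chem. Phys. 134 (Wiley, 2007) 21–59, §II.F
  eqs. (87)–(90) (traces of the spin blocks), §II.F.1 eqs. (96)–(98) (`S`-representability).
  [cite: Mazziotti2007RDMChapter, §II.F eqs. (87)-(90), (96)-(98)]
* E. H. Lieb, *Two theorems on the Hubbard model*, Phys. Rev. Lett. 62 (1989) 1201, eq. (2)
  (work in a sector of fixed `N_↑`, `N_↓`). [cite: LiebPRL1989, eq. (2)]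
-/

noncomputable section

namespace Literature.MathematicalPhysics.QuantumChemistry

open Matrix Finset Literature.MathematicalPhysics.QuantumLattice
open scoped ComplexOrder

variable {Λ : Type*} [LinearOrder Λ] [Fintype Λ]

/-! ### Sector bookkeeping (private helpers) -/

/-- `N̂_↑ ψ = a ψ` in the sector `(a, b)`. [folklore] -/
private theorem sum_numberOp_up_mulVec {a b : ℕ} {ψ : Fock (Orb Λ)} (hψ : IsInSector a b ψ) :
    (∑ y : Λ, numberOp y 0) *ᵥ ψ = (a : ℂ) • ψ := by
  funext s
  rw [Matrix.sum_mulVec, Finset.sum_apply, Pi.smul_apply, smul_eq_mul]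
  simp only [LiebThm1.numberOp_eq_diagonal, mulVec_diagonal]
  rw [← Finset.sum_mul, Finset.sum_boole]
  by_cases hs : (upPart s).card = a ∧ (downPart s).card = b
  · rw [← hs.1]; rfl
  · rw [hψ s hs, mul_zero, mul_zero]

/-- `N̂_↓ ψ = b ψ` in the sector `(a, b)`. [folklore] -/
private theorem sum_numberOp_down_mulVec {a b : ℕ} {ψ : Fock (Orb Λ)} (hψ : IsInSector a b ψ) :
    (∑ y : Λ, numberOp y 1) *ᵥ ψ = (b : ℂ) • ψ := by
  funext s
  rw [Matrix.sum_mulVec, Finset.sum_apply, Pi.smul_apply, smul_eq_mul]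
  simp only [LiebThm1.numberOp_eq_diagonal, mulVec_diagonal]
  rw [← Finset.sum_mul, Finset.sum_boole]
  by_cases hs : (upPart s).card = a ∧ (downPart s).card = b
  · rw [← hs.2]; rfl
  · rw [hψ s hs, mul_zero, mul_zero]

/-- `Ŝ_z ψ = ((a − b)/2) ψ` in the sector `(a, b)`. [folklore] -/
private theorem spinZ_mulVec_of_isInSector {a b : ℕ} {ψ : Fock (Orb Λ)} (hψ : IsInSector a b ψ) :
    HubbardWave0.spinZ *ᵥ ψ = (((((a : ℝ) - b) / 2 : ℝ)) : ℂ) • ψ :=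
  ((mem_szSector_iff _ _ ψ).1 ((mem_szSector_iff_isInSector a b ψ).2 hψ)).2

/-- `N̂_↑ (a_{qτ} ψ) = (a − δ_{τα}) a_{qτ} ψ` in the sector `(a, b)`. [folklore] -/
private theorem sum_numberOp_up_mulVec_annihilation {a b : ℕ} {ψ : Fock (Orb Λ)} (hψ : IsInSector a b ψ)
    (q : Λ) (τ : Fin 2) :
    (∑ y : Λ, numberOp y 0) *ᵥ (annihilation (orb q τ) *ᵥ ψ) =
      ((a : ℂ) - if (0 : Fin 2) = τ then 1 else 0) • (annihilation (orb q τ) *ᵥ ψ) := by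
  fin_cases τ
  · simp only [Fin.zero_eta, Fin.isValue, if_true]
    cases a with
    | zero => rw [hψ.annihilation_up_mulVec_eq_zero q, mulVec_zero, smul_zero]
    | succ a' =>
      rw [sum_numberOp_up_mulVec (hψ.annihilation_up_mulVec q)]
      push_cast; ring_nf
  · simp only [Fin.mk_one, Fin.isValue, zero_ne_one, if_false, sub_zero]
    cases b with
    | zero => rw [hψ.annihilation_down_mulVec_eq_zero q, mulVec_zero, smul_zero]
    | succ b' => rw [sum_numberOp_up_mulVec (hψ.annihilation_down_mulVec q)]

/-- `N̂_↓ (a_{qτ} ψ) = (b − δ_{τβ}) a_{qτ} ψ` in the sector `(a, b)`. [folklore] -/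
private theorem sum_numberOp_down_mulVec_annihilation {a b : ℕ} {ψ : Fock (Orb Λ)}
    (hψ : IsInSector a b ψ) (q : Λ) (τ : Fin 2) :
    (∑ y : Λ, numberOp y 1) *ᵥ (annihilation (orb q τ) *ᵥ ψ) =
      ((b : ℂ) - if (1 : Fin 2) = τ then 1 else 0) • (annihilation (orb q τ) *ᵥ ψ) := by
  fin_cases τ
  · simp only [Fin.zero_eta, Fin.isValue, one_ne_zero, if_false, sub_zero]
    cases a with
    | zero => rw [hψ.annihilation_up_mulVec_eq_zero q, mulVec_zero, smul_zero]
    | succ a' => rw [sum_numberOp_down_mulVec (hψ.annihilation_up_mulVec q)]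
  · simp only [Fin.mk_one, Fin.isValue, if_true]
    cases b with
    | zero => rw [hψ.annihilation_down_mulVec_eq_zero q, mulVec_zero, smul_zero]
    | succ b' =>
      rw [sum_numberOp_down_mulVec (hψ.annihilation_down_mulVec q)]
      push_cast; ring_nf

/-! ### `S_z` selection rule and spin-resolved traces of the 1-RDM -/

/-- **`S_z` selection rule of the 1-RDM**: in a sector of fixed `(N_α, N_β)`,
`¹D^{pσ}_{qτ} = ⟨ψ| a†_{pσ} a_{qτ} |ψ⟩ = 0` whenever `σ ≠ τ` (the word `a†_{pσ} a_{qτ}` carries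
`Ŝ_z`-charge `±1`; "for a ground-state wavefunction with a definite … z-component M … basis functions
with different m are orthogonal"). Mazziotti (2007) §II.F. [cite: Mazziotti2007RDMChapter, §II.F] -/
theorem oneRDM_orb_eq_zero_of_ne {a b : ℕ} {ψ : Fock (Orb Λ)} (hψ : IsInSector a b ψ) (p q : Λ)
    {σ τ : Fin 2} (h : σ ≠ τ) : oneRDM ψ (orb p σ) (orb q τ) = 0 := by
  have hw : ladderWord [(orb p σ, true), (orb q τ, false)] = creation (orb p σ) * annihilation (orb q τ) := by
    simp [ladderWord_cons, ladderLetter]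
  have hc : ladderSpinCharge [(orb p σ, true), (orb q τ, false)] ≠ 0 := by
    fin_cases σ <;> fin_cases τ
    · exact absurd rfl h
    · simp [ladderSpinCharge, letterSpinCharge, orb]
    · simp [ladderSpinCharge, letterSpinCharge, orb]
    · exact absurd rfl h
  rw [oneRDM, ← hw]
  exact star_dotProduct_ladderWord_mulVec_eq_zero_of_spinCharge (spinZ_mulVec_of_isInSector hψ) _ hc

/-- **Trace of the `αα` block of the 1-RDM**: `Σ_x ¹D^{xα}_{xα} = N_α ⟨ψ,ψ⟩` in the sector
`(N_α, N_β)` (`Σ_x n_{xα} = N̂_α`). Mazziotti (2007) §II.F (with §II.D.1); Lieb (1989) eq. (2).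
[cite: Mazziotti2007RDMChapter, §II.F] -/
theorem sum_oneRDM_up {a b : ℕ} {ψ : Fock (Orb Λ)} (hψ : IsInSector a b ψ) :
    ∑ x, oneRDM ψ (orb x 0) (orb x 0) = (a : ℂ) * (star ψ ⬝ᵥ ψ) := by
  have h : ∑ x, oneRDM ψ (orb x 0) (orb x 0) = star ψ ⬝ᵥ (∑ y : Λ, numberOp y 0) *ᵥ ψ := by
    simp only [oneRDM, numberOp, Matrix.sum_mulVec, dotProduct_sum]
  rw [h, sum_numberOp_up_mulVec hψ, dotProduct_smul, smul_eq_mul]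

/-- **Trace of the `ββ` block of the 1-RDM**: `Σ_x ¹D^{xβ}_{xβ} = N_β ⟨ψ,ψ⟩` in the sector
`(N_α, N_β)`. Mazziotti (2007) §II.F; Lieb (1989) eq. (2). [cite: Mazziotti2007RDMChapter, §II.F] -/
theorem sum_oneRDM_down {a b : ℕ} {ψ : Fock (Orb Λ)} (hψ : IsInSector a b ψ) :
    ∑ x, oneRDM ψ (orb x 1) (orb x 1) = (b : ℂ) * (star ψ ⬝ᵥ ψ) := by
  have h : ∑ x, oneRDM ψ (orb x 1) (orb x 1) = star ψ ⬝ᵥ (∑ y : Λ, numberOp y 1) *ᵥ ψ := by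
    simp only [oneRDM, numberOp, Matrix.sum_mulVec, dotProduct_sum]
  rw [h, sum_numberOp_down_mulVec hψ, dotProduct_smul, smul_eq_mul]

/-! ### Spin-resolved contractions of the 2-RDM -/

/-- **Contraction of the 2-RDM over the `α` orbitals**: in the sector `(N_α, N_β)`,
`Σ_y ²D^{P, yα}_{qτ, yα} = (N_α − δ_{τα}) ¹D^{P}_{qτ}` (`Σ_y a†_P a†_{yα} a_{yα} a_{qτ} = a†_P N̂_α a_{qτ}`
and `a_{qτ}` removes one `α` electron iff `τ = α`; the spin-resolved form of Mazziotti's eq. (16)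
behind the block traces (87)–(90)). [cite: Mazziotti2007RDMChapter, §II.F eqs. (87)-(90)] -/
theorem sum_twoRDM_orb_up {a b : ℕ} {ψ : Fock (Orb Λ)} (hψ : IsInSector a b ψ) (P : Orb Λ) (q : Λ)
    (τ : Fin 2) :
    ∑ y, twoRDM ψ (P, orb y 0) (orb q τ, orb y 0) =
      ((a : ℂ) - if (0 : Fin 2) = τ then 1 else 0) * oneRDM ψ P (orb q τ) := by
  have h : ∑ y, twoRDM ψ (P, orb y 0) (orb q τ, orb y 0) =
      star ψ ⬝ᵥ (creation P * (∑ y : Λ, numberOp y 0) * annihilation (orb q τ)) *ᵥ ψ := by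
    simp only [twoRDM, numberOp, Finset.mul_sum, Finset.sum_mul, Matrix.sum_mulVec, dotProduct_sum,
      Matrix.mul_assoc]
  rw [h, ← mulVec_mulVec, ← mulVec_mulVec, sum_numberOp_up_mulVec_annihilation hψ q τ, mulVec_smul,
    dotProduct_smul, smul_eq_mul, oneRDM, ← mulVec_mulVec]

/-- **Contraction of the 2-RDM over the `β` orbitals**: in the sector `(N_α, N_β)`,
`Σ_y ²D^{P, yβ}_{qτ, yβ} = (N_β − δ_{τβ}) ¹D^{P}_{qτ}`. [cite: Mazziotti2007RDMChapter, §II.F eqs. (87)-(90)] -/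
theorem sum_twoRDM_orb_down {a b : ℕ} {ψ : Fock (Orb Λ)} (hψ : IsInSector a b ψ) (P : Orb Λ) (q : Λ)
    (τ : Fin 2) :
    ∑ y, twoRDM ψ (P, orb y 1) (orb q τ, orb y 1) =
      ((b : ℂ) - if (1 : Fin 2) = τ then 1 else 0) * oneRDM ψ P (orb q τ) := by
  have h : ∑ y, twoRDM ψ (P, orb y 1) (orb q τ, orb y 1) =
      star ψ ⬝ᵥ (creation P * (∑ y : Λ, numberOp y 1) * annihilation (orb q τ)) *ᵥ ψ := by
    simp only [twoRDM, numberOp, Finset.mul_sum, Finset.sum_mul, Matrix.sum_mulVec, dotProduct_sum,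
      Matrix.mul_assoc]
  rw [h, ← mulVec_mulVec, ← mulVec_mulVec, sum_numberOp_down_mulVec_annihilation hψ q τ, mulVec_smul,
    dotProduct_smul, smul_eq_mul, oneRDM, ← mulVec_mulVec]

/-! ### Traces of the spin blocks of the 2-RDM (Mazziotti eqs. (87)–(90)) -/

/-- **Trace of the `αα` block** (Mazziotti (2007) eq. (89), `Tr ²D^{1,1} = (N/2 + M)(N/2 + M − 1)`, in
second-quantised normalisation): `Σ_{xy} ²D^{xα yα}_{xα yα} = N_α (N_α − 1) ⟨ψ,ψ⟩` in the sector
`(N_α, N_β)`. [cite: Mazziotti2007RDMChapter, §II.F eq. (89)] -/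
theorem sum_twoRDM_upUp {a b : ℕ} {ψ : Fock (Orb Λ)} (hψ : IsInSector a b ψ) :
    ∑ x, ∑ y, twoRDM ψ (orb x 0, orb y 0) (orb x 0, orb y 0) = (a : ℂ) * ((a : ℂ) - 1) * (star ψ ⬝ᵥ ψ) := by
  simp_rw [sum_twoRDM_orb_up hψ]
  rw [← Finset.mul_sum, sum_oneRDM_up hψ, if_true]
  ring

/-- **Trace of the `ββ` block** (Mazziotti (2007) eq. (90), `Tr ²D^{1,−1} = (N/2 − M)(N/2 − M − 1)`):
`Σ_{xy} ²D^{xβ yβ}_{xβ yβ} = N_β (N_β − 1) ⟨ψ,ψ⟩` in the sector `(N_α, N_β)`.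
[cite: Mazziotti2007RDMChapter, §II.F eq. (90)] -/
theorem sum_twoRDM_downDown {a b : ℕ} {ψ : Fock (Orb Λ)} (hψ : IsInSector a b ψ) :
    ∑ x, ∑ y, twoRDM ψ (orb x 1, orb y 1) (orb x 1, orb y 1) = (b : ℂ) * ((b : ℂ) - 1) * (star ψ ⬝ᵥ ψ) := by
  simp_rw [sum_twoRDM_orb_down hψ]
  rw [← Finset.mul_sum, sum_oneRDM_down hψ, if_true]
  ring

/-- **Trace of the `αβ` block** (the sum of Mazziotti's singlet and `m = 0` triplet traces, eqs.
(87) + (88): `N(N+2)/4 − S(S+1) + N(N−2)/4 − 2M² + S(S+1) = 2 N_α N_β`, each ordered pair counted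
once here): `Σ_{xy} ²D^{xα yβ}_{xα yβ} = N_α N_β ⟨ψ,ψ⟩` in the sector `(N_α, N_β)`.
[cite: Mazziotti2007RDMChapter, §II.F eqs. (87)-(88)] -/
theorem sum_twoRDM_upDown {a b : ℕ} {ψ : Fock (Orb Λ)} (hψ : IsInSector a b ψ) :
    ∑ x, ∑ y, twoRDM ψ (orb x 0, orb y 1) (orb x 0, orb y 1) = (a : ℂ) * (b : ℂ) * (star ψ ⬝ᵥ ψ) := by
  simp_rw [sum_twoRDM_orb_down hψ]
  rw [← Finset.mul_sum, sum_oneRDM_up hψ]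
  simp only [Fin.isValue, one_ne_zero, if_false, sub_zero]
  ring

/-! ### The `S`-representability sum rule (Mazziotti eqs. (96)–(98)) -/

/-- **`Ŝ_− Ŝ_+` in normal order**: `Ŝ_− Ŝ_+ = N̂_β − Σ_{xy} a†_{xα} a†_{yβ} a_{xβ} a_{yα}` (operator
identity on the Fock space; `Ŝ_+ = Σ_x a†_{xα} a_{xβ}`, `Ŝ_− = Ŝ_+†`; one use of
`a_{yα} a†_{xα} = δ_{xy} − a†_{xα} a_{yα}` and two anticommutations). The operator behind Mazziotti's
(2007) eqs. (96)–(98). [cite: Mazziotti2007RDMChapter, §II.F.1 eqs. (96)-(98)] -/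
theorem spinMinus_mul_spinPlus_eq :
    (spinMinus * spinPlus : Matrix (Finset (Orb Λ)) (Finset (Orb Λ)) ℂ) =
      ∑ y : Λ, numberOp y 1 -
        ∑ x : Λ, ∑ y : Λ, creation (orb x 0) * creation (orb y 1) * annihilation (orb x 1) *
          annihilation (orb y 0) := by
  have hminus : (spinMinus : Matrix (Finset (Orb Λ)) (Finset (Orb Λ)) ℂ) =
      ∑ y : Λ, creation (orb y 1) * annihilation (orb y 0) := by
    rw [spinMinus, spinPlus, conjTranspose_sum]
    refine Finset.sum_congr rfl fun y _ => ?_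
    rw [conjTranspose_mul, creation_conjTranspose, annihilation_conjTranspose]
  -- each term `a†_{yβ} a_{yα} a†_{xα} a_{xβ}` in normal order
  have hterm : ∀ x y : Λ, creation (orb y 1) * annihilation (orb y 0) *
      (creation (orb x 0) * annihilation (orb x 1)) =
      (if x = y then creation (orb y 1) * annihilation (orb x 1) else 0) -
        creation (orb x 0) * creation (orb y 1) * annihilation (orb x 1) * annihilation (orb y 0) := by
    intro x y
    have hδ : (if orb y 0 = orb x 0 then (1 : Matrix (Finset (Orb Λ)) (Finset (Orb Λ)) ℂ) else 0) =
        if x = y then 1 else 0 := by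
      by_cases hxy : x = y
      · rw [if_pos hxy, if_pos (by rw [hxy])]
      · rw [if_neg hxy, if_neg (fun h => hxy (orb_eq_orb_iff.1 h).1.symm)]
    have h1 : annihilation (orb y 0) * creation (orb x 0) =
        (if x = y then (1 : Matrix (Finset (Orb Λ)) (Finset (Orb Λ)) ℂ) else 0) -
          creation (orb x 0) * annihilation (orb y 0) := by
      rw [annihilation_mul_creation, hδ]
    have h2 : creation (orb y 1) * creation (orb x 0) = -(creation (orb x 0) * creation (orb y 1)) :=
      creation_mul_creation_eq_neg _ _
    have h3 : annihilation (orb y 0) * annihilation (orb x 1) =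
        -(annihilation (orb x 1) * annihilation (orb y 0)) :=
      eq_neg_of_add_eq_zero_left (annihilation_anticommute_holds (ι := Orb Λ) _ _)
    have hite : creation (orb y 1) * (if x = y then (1 : Matrix (Finset (Orb Λ)) (Finset (Orb Λ)) ℂ) else 0) *
        annihilation (orb x 1) = if x = y then creation (orb y 1) * annihilation (orb x 1) else 0 := by
      split_ifs
      · rw [Matrix.mul_one]
      · rw [Matrix.mul_zero, Matrix.zero_mul]
    calc creation (orb y 1) * annihilation (orb y 0) * (creation (orb x 0) * annihilation (orb x 1))
        = creation (orb y 1) * (annihilation (orb y 0) * creation (orb x 0)) * annihilation (orb x 1) := by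
          simp only [Matrix.mul_assoc]
      _ = creation (orb y 1) * (if x = y then (1 : Matrix (Finset (Orb Λ)) (Finset (Orb Λ)) ℂ) else 0) *
              annihilation (orb x 1) -
            creation (orb y 1) * creation (orb x 0) * (annihilation (orb y 0) * annihilation (orb x 1)) := by
          rw [h1, Matrix.mul_sub, Matrix.sub_mul]
          simp only [Matrix.mul_assoc]
      _ = _ := by
          rw [hite, h2, h3, neg_mul, mul_neg, neg_neg]
          simp only [Matrix.mul_assoc]
  rw [hminus, spinPlus, Finset.sum_mul_sum]
  simp_rw [hterm]
  simp only [Finset.sum_sub_distrib]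
  have hA : ∑ y : Λ, ∑ x : Λ, (if x = y then creation (orb y 1) * annihilation (orb x 1)
      else (0 : Matrix (Finset (Orb Λ)) (Finset (Orb Λ)) ℂ)) = ∑ y : Λ, numberOp y 1 := by
    refine Finset.sum_congr rfl fun y _ => ?_
    rw [Finset.sum_ite_eq' Finset.univ y, if_pos (Finset.mem_univ y), numberOp]
  rw [hA, Finset.sum_comm]

/-- **The `S`-representability sum rule** (Mazziotti (2007) eqs. (96)–(98)): in the sector
`(N_α, N_β)`, `⟨ψ| Ŝ_−Ŝ_+ |ψ⟩ + Σ_{xy} ²D^{xα, yβ}_{yα, xβ} = N_β ⟨ψ,ψ⟩`; with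
`⟨Ŝ_−Ŝ_+⟩ = ⟨Ŝ²⟩ − M(M+1)` (eq. (97)) and `N_β = N/2 − M` this is eq. (98)
`Σ_{ij} ²D^{iα,jβ}_{jα,iβ} = N/2 + M² − S(S+1)` for a state with `⟨Ŝ²⟩ = S(S+1)` — "the
`S`-representability condition … must be enforced in addition to the 2-positivity conditions" when
only `Ŝ_z` symmetry is used. [cite: Mazziotti2007RDMChapter, §II.F.1 eqs. (96)-(98)] -/
theorem expect_spinMinus_spinPlus_add_sum_twoRDM {a b : ℕ} {ψ : Fock (Orb Λ)} (hψ : IsInSector a b ψ) :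
    star ψ ⬝ᵥ (spinMinus * spinPlus) *ᵥ ψ +
        ∑ x, ∑ y, twoRDM ψ (orb x 0, orb y 1) (orb y 0, orb x 1) = (b : ℂ) * (star ψ ⬝ᵥ ψ) := by
  have h2 : ∑ x, ∑ y, twoRDM ψ (orb x 0, orb y 1) (orb y 0, orb x 1) =
      star ψ ⬝ᵥ (∑ x : Λ, ∑ y : Λ, creation (orb x 0) * creation (orb y 1) * annihilation (orb x 1) *
        annihilation (orb y 0)) *ᵥ ψ := by
    simp only [twoRDM, Matrix.sum_mulVec, dotProduct_sum]
  rw [h2, spinMinus_mul_spinPlus_eq, sub_mulVec, dotProduct_sub, sub_add_cancel,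
    sum_numberOp_down_mulVec hψ, dotProduct_smul, smul_eq_mul]

/-- **Sum rule for states annihilated by `Ŝ_+`** (highest-weight vectors; the singlet-restricted
states `⟨Ŝ_−Ŝ_+⟩ = 0` of the sector `(n, n)`): `Σ_{xy} ²D^{xα, yβ}_{yα, xβ} = N_β ⟨ψ,ψ⟩` — eq. (98)
with `S = M`. [cite: Mazziotti2007RDMChapter, §II.F.1 eq. (98)] -/
theorem sum_twoRDM_exchange_of_spinPlus_eq_zero {a b : ℕ} {ψ : Fock (Orb Λ)} (hψ : IsInSector a b ψ)
    (h0 : spinPlus *ᵥ ψ = 0) :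
    ∑ x, ∑ y, twoRDM ψ (orb x 0, orb y 1) (orb y 0, orb x 1) = (b : ℂ) * (star ψ ⬝ᵥ ψ) := by
  have h := expect_spinMinus_spinPlus_add_sum_twoRDM hψ
  rwa [← mulVec_mulVec, h0, mulVec_zero, dotProduct_zero, zero_add] at h

end Literature.MathematicalPhysics.QuantumChemistry

end
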